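import Summits.BirchSwinnertonDyer.Rank1Residual.GaloisImage.CongruenceVisibilityIdentityComponent
import HarnessLib

/-!
# THEOREM B record shape with the σ-decider at the `K_v`-point level (cell `b2b-bsdres`, team
# n1011, seat p10 GEN 8; FILE 8c)

HONEST FRAMING (cell `b2b-bsdres`, run/shared/lean/b2b/bsd-rank1-residual/, verbatim in every
file): the goal of the cell is to DELETE the COMBINATION-SHAPED residual classes of the
Birch–Swinnerton-Dyer formula for ALL analytic-rank `≤ 1` elliptic curves over `ℚ` — "full BSD
formula for every rank `≤ 1` curve in class `C`" assembled STRICTLY from published theorems — so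
that the rank-`≤ 1` remainder becomes exactly the CONSTRUCTION-SHAPED classes, which are TYPED
(missing-input `Prop`s), NOT attempted. This is not "finishing BSD". Team n1011 (N10 / N11):
research route on the CONSTRUCTION-SHAPED class X4 (§I N11 LOWER half); no claim beyond the stated
classes; nothing is booked; marks UNCHANGED. Theorems only: no definition, no named fact, no
`sorry`. RECORD-SHAPE theorem; it closes nothing by itself.

## What

`exists_sha_ne_zero_of_congr_of_identityComponent_of_torsionIntegral`: the record shape of FILE 8b
(`exists_sha_ne_zero_of_congr_of_identityComponent`) with the identity-component datum stated on
the `K_{v₀}`-POINTS of the curves, as the decider lane computes it: for each curve, besides the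
integral model `M` at `3` (`C • W_{K_{v₀}} = M ⊗ K_{v₀}`) with its cusp, the hypothesis
"EVERY non-zero `3`-torsion point `T ∈ E(K_{v₀})` has, on `M`, integral coordinates `(a₀, b₀)` with
NONSINGULAR reduction" (`hE0`). The `K̄_{v₀}`-level binders `hm`, `h3` of FILE 8b are derived here
(`3`-torsion transported along `C` and `K_{v₀} → K̄_{v₀}`), and `T` itself comes from `#E(K_{v₀})[3] = 3`.

References: L41-NOTE §§1–2; [SilvermanAEC2009] VII.2.1.
-/

noncomputable section

open scoped Classical

namespace Summit.BirchSwinnertonDyer.Rank1Residual.GaloisImage.TwistedWitness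

open WeierstrassCurve Literature.NumberTheory.EllipticCurves Literature.NumberTheory.GaloisRepresentations
open Field NumberField IsDedekindDomain IsDedekindDomain.HeightOneSpectrum

/-- From `#E(K_v)[3] = 3` and the decider hypothesis `hE0`: an integral `3`-torsion point of `M`
with nonsingular reduction, read in `V(K̄_v)`. [folklore] -/
theorem exists_identityComponent_torsion_of_card {K : Type} [Field K] [NumberField K]
    {v₀ : HeightOneSpectrum (𝓞 K)} (W : WeierstrassCurve K) [W.IsElliptic]
    (M : WeierstrassCurve (v₀.adicCompletionIntegers K)) (C : VariableChange (v₀.adicCompletion K))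
    (hC : C • W.baseChange (v₀.adicCompletion K) =
      M.map (algebraMap (v₀.adicCompletionIntegers K) (v₀.adicCompletion K)))
    (hcard : Nat.card (nsmulAddMonoidHom 3 :
      (W.baseChange (v₀.adicCompletion K)).toAffine.Point →+ _).ker = 3)
    (hE0 : ∀ T : (W.baseChange (v₀.adicCompletion K)).toAffine.Point, 3 • T = 0 → T ≠ 0 →
      ∃ (a₀ b₀ : v₀.adicCompletionIntegers K)
        (h : (M.map (algebraMap (v₀.adicCompletionIntegers K) (v₀.adicCompletion K))).toAffine.Nonsingular
          (a₀ : v₀.adicCompletion K) (b₀ : v₀.adicCompletion K)),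
        Affine.Point.congrEquiv hC (VariableChange.pointEquiv (W.baseChange (v₀.adicCompletion K)) C T) =
          .some _ _ h ∧
        (M.map (IsLocalRing.residue (v₀.adicCompletionIntegers K))).toAffine.Nonsingular
          (IsLocalRing.residue (v₀.adicCompletionIntegers K) a₀)
          (IsLocalRing.residue (v₀.adicCompletionIntegers K) b₀)) :
    ∃ (a₀ b₀ : v₀.adicCompletionIntegers K)
      (_ : (M.map (IsLocalRing.residue (v₀.adicCompletionIntegers K))).toAffine.Nonsingular
        (IsLocalRing.residue (v₀.adicCompletionIntegers K) a₀)
        (IsLocalRing.residue (v₀.adicCompletionIntegers K) b₀))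
      (hm : ((M.map (algebraMap (v₀.adicCompletionIntegers K) (v₀.adicCompletion K))).baseChange
          (AlgebraicClosure (v₀.adicCompletion K))).toAffine.Nonsingular
        (algebraMap (v₀.adicCompletionIntegers K) (AlgebraicClosure (v₀.adicCompletion K)) a₀)
        (algebraMap (v₀.adicCompletionIntegers K) (AlgebraicClosure (v₀.adicCompletion K)) b₀)),
      (3 : ℤ) • (Affine.Point.some _ _ hm :
        ((M.map (algebraMap (v₀.adicCompletionIntegers K) (v₀.adicCompletion K))).baseChange
          (AlgebraicClosure (v₀.adicCompletion K))).toAffine.Point) = 0 := by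
  -- a non-zero `3`-torsion point of `E(K_v)`
  haveI : Finite (nsmulAddMonoidHom 3 :
      (W.baseChange (v₀.adicCompletion K)).toAffine.Point →+ _).ker :=
    Nat.finite_of_card_ne_zero (by rw [hcard]; norm_num)
  have hnt : Nontrivial (nsmulAddMonoidHom 3 :
      (W.baseChange (v₀.adicCompletion K)).toAffine.Point →+ _).ker := by
    rw [← Finite.one_lt_card_iff_nontrivial, hcard]; norm_num
  obtain ⟨⟨T, hTker⟩, hT0⟩ := exists_ne (0 : (nsmulAddMonoidHom 3 :
      (W.baseChange (v₀.adicCompletion K)).toAffine.Point →+ _).ker)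
  have hT0' : T ≠ 0 := fun h ↦ hT0 (Subtype.ext h)
  have hT3 : 3 • T = 0 := by rwa [AddMonoidHom.mem_ker, nsmulAddMonoidHom_apply] at hTker
  obtain ⟨a₀, b₀, hK, hTab, hns₀⟩ := hE0 T hT3 hT0'
  -- read in `V(K̄_v)`: along `X₀ = X₀ ⊗_{K_v} K_v` and `K_v → K̄_v`
  have hself : (M.map (algebraMap (v₀.adicCompletionIntegers K) (v₀.adicCompletion K))).baseChange
      (v₀.adicCompletion K) = M.map (algebraMap (v₀.adicCompletionIntegers K) (v₀.adicCompletion K)) := by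
    rw [baseChange, Algebra.algebraMap_self, WeierstrassCurve.map_id]
  set ι : ((M.map (algebraMap (v₀.adicCompletionIntegers K) (v₀.adicCompletion K))).baseChange
      (v₀.adicCompletion K)).toAffine.Point →+
      ((M.map (algebraMap (v₀.adicCompletionIntegers K) (v₀.adicCompletion K))).baseChange
        (AlgebraicClosure (v₀.adicCompletion K))).toAffine.Point :=
    WeierstrassCurve.Affine.Point.map
      (W' := M.map (algebraMap (v₀.adicCompletionIntegers K) (v₀.adicCompletion K)))
      (Algebra.ofId (v₀.adicCompletion K) (AlgebraicClosure (v₀.adicCompletion K))) with hιdef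
  have hm : ((M.map (algebraMap (v₀.adicCompletionIntegers K) (v₀.adicCompletion K))).baseChange
        (AlgebraicClosure (v₀.adicCompletion K))).toAffine.Nonsingular
      (algebraMap (v₀.adicCompletionIntegers K) (AlgebraicClosure (v₀.adicCompletion K)) a₀)
      (algebraMap (v₀.adicCompletionIntegers K) (AlgebraicClosure (v₀.adicCompletion K)) b₀) := by
    rw [IsScalarTower.algebraMap_apply (v₀.adicCompletionIntegers K) (v₀.adicCompletion K)
      (AlgebraicClosure (v₀.adicCompletion K)) a₀,
      IsScalarTower.algebraMap_apply (v₀.adicCompletionIntegers K) (v₀.adicCompletion K)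
      (AlgebraicClosure (v₀.adicCompletion K)) b₀]
    exact (Affine.map_nonsingular
      (W := M.map (algebraMap (v₀.adicCompletionIntegers K) (v₀.adicCompletion K)))
      (f := algebraMap (v₀.adicCompletion K) (AlgebraicClosure (v₀.adicCompletion K)))
      (RingHom.injective _) _ _).mpr hK
  refine ⟨a₀, b₀, hns₀, hm, ?_⟩
  have e : (Affine.Point.some _ _ hm :
      ((M.map (algebraMap (v₀.adicCompletionIntegers K) (v₀.adicCompletion K))).baseChange
        (AlgebraicClosure (v₀.adicCompletion K))).toAffine.Point) =
      ι (Affine.Point.congrEquiv hself.symm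
        (Affine.Point.congrEquiv hC (VariableChange.pointEquiv (W.baseChange (v₀.adicCompletion K)) C T))) := by
    rw [hTab, Affine.Point.congrEquiv_some, hιdef, Affine.Point.map_some]
    exact point_some_eq_some
      (IsScalarTower.algebraMap_apply (v₀.adicCompletionIntegers K) (v₀.adicCompletion K) _ a₀)
      (IsScalarTower.algebraMap_apply (v₀.adicCompletionIntegers K) (v₀.adicCompletion K) _ b₀)
  have hT3z : (3 : ℤ) • T = 0 := by exact_mod_cast hT3
  rw [e, ← map_zsmul, ← map_zsmul, ← map_zsmul, ← map_zsmul, hT3z, map_zero, map_zero, map_zero, map_zero]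

/-- **THEOREM B record shape with the σ-decider on `K_{v₀}`-points.** As
`exists_sha_ne_zero_of_congr_of_identityComponent`, the identity-component data of each curve
being: an integral model at `3` with its cusp, and `hE0` = "every non-zero `3`-torsion point of
`E(K_{v₀})` has integral coordinates with nonsingular reduction on that model".
[cite: CremonaMazur2000, §3 pp. 19–22] [cite: MilneADT2006, Ch. I Prop. 3.8 and Lemma 3.3] -/
theorem exists_sha_ne_zero_of_congr_of_identityComponent_of_torsionIntegral {K : Type} [Field K]
    [NumberField K] (W W' : WeierstrassCurve K) [W.IsElliptic] [W'.IsElliptic]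
    (θ : geomTorsion W' ((3 : ℕ) : ℤ) ≃+ geomTorsion W ((3 : ℕ) : ℤ))
    (hθ : ∀ (σ : absoluteGaloisGroup K) (P : geomTorsion W' ((3 : ℕ) : ℤ)), θ (σ • P) = σ • θ P)
    (S : Finset (HeightOneSpectrum (𝓞 K)))
    (hS : ∀ v : HeightOneSpectrum (𝓞 K), v ∉ S →
      W.HasGoodReductionAt v ∧ W'.HasGoodReductionAt v ∧ ((3 : ℕ) : 𝓞 K) ∉ v.asIdeal)
    (hfin : Finite W.toAffine.Point) (hcop : (Nat.card W.toAffine.Point).Coprime 3)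
    (P₁ P₂ : W'.toAffine.Point)
    (hind : ∀ c₁ c₂ : ℤ, c₁ • P₁ + c₂ • P₂ ∈
      (zsmulAddGroupHom ((3 : ℕ) : ℤ) : W'.toAffine.Point →+ W'.toAffine.Point).range →
      (3 : ℤ) ∣ c₁ ∧ (3 : ℤ) ∣ c₂)
    (v₀ : HeightOneSpectrum (𝓞 K)) (h3v : ((3 : ℕ) : 𝓞 K) ∈ v₀.asIdeal)
    (hO3 : Nat.card (v₀.adicCompletionIntegers K ⧸
      Ideal.span {((3 : ℕ) : v₀.adicCompletionIntegers K)}) = 3)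
    {δ : v₀.adicCompletion K} (hδ : δ ^ 2 = -23)
    (hnoroot : ∀ x : v₀.adicCompletion K, x ^ 3 - x - 1 ≠ 0)
    (hn3 : ∀ y : v₀.adicCompletion K, y ^ 2 ≠ -3)
    (hoff : ∀ v ∈ S, v ≠ v₀ →
      (selmerLocalKer W (v.adicCompletion K) ((3 : ℕ) : ℤ)).relIndex
        ((selmerLocalKer W' (v.adicCompletion K) ((3 : ℕ) : ℤ)).map (h1Equiv θ hθ).toAddMonoidHom) = 1)
    (hcard : Nat.card (nsmulAddMonoidHom 3 :
      (W.baseChange (v₀.adicCompletion K)).toAffine.Point →+ _).ker = 3)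
    (hcard' : Nat.card (nsmulAddMonoidHom 3 :
      (W'.baseChange (v₀.adicCompletion K)).toAffine.Point →+ _).ker = 3)
    (M : WeierstrassCurve (v₀.adicCompletionIntegers K)) (C : VariableChange (v₀.adicCompletion K))
    (hC : C • W.baseChange (v₀.adicCompletion K) =
      M.map (algebraMap (v₀.adicCompletionIntegers K) (v₀.adicCompletion K)))
    (x₀ y₀ a : IsLocalRing.ResidueField (v₀.adicCompletionIntegers K))
    (hcusp : M.map (IsLocalRing.residue (v₀.adicCompletionIntegers K)) = singularModel x₀ y₀ a a)
    (hE0 : ∀ T : (W.baseChange (v₀.adicCompletion K)).toAffine.Point, 3 • T = 0 → T ≠ 0 →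
      ∃ (a₀ b₀ : v₀.adicCompletionIntegers K)
        (h : (M.map (algebraMap (v₀.adicCompletionIntegers K) (v₀.adicCompletion K))).toAffine.Nonsingular
          (a₀ : v₀.adicCompletion K) (b₀ : v₀.adicCompletion K)),
        Affine.Point.congrEquiv hC (VariableChange.pointEquiv (W.baseChange (v₀.adicCompletion K)) C T) =
          .some _ _ h ∧
        (M.map (IsLocalRing.residue (v₀.adicCompletionIntegers K))).toAffine.Nonsingular
          (IsLocalRing.residue (v₀.adicCompletionIntegers K) a₀)
          (IsLocalRing.residue (v₀.adicCompletionIntegers K) b₀))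
    (M' : WeierstrassCurve (v₀.adicCompletionIntegers K)) (C' : VariableChange (v₀.adicCompletion K))
    (hC' : C' • W'.baseChange (v₀.adicCompletion K) =
      M'.map (algebraMap (v₀.adicCompletionIntegers K) (v₀.adicCompletion K)))
    (x₀' y₀' a' : IsLocalRing.ResidueField (v₀.adicCompletionIntegers K))
    (hcusp' : M'.map (IsLocalRing.residue (v₀.adicCompletionIntegers K)) = singularModel x₀' y₀' a' a')
    (hE0' : ∀ T : (W'.baseChange (v₀.adicCompletion K)).toAffine.Point, 3 • T = 0 → T ≠ 0 →
      ∃ (a₀ b₀ : v₀.adicCompletionIntegers K)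
        (h : (M'.map (algebraMap (v₀.adicCompletionIntegers K) (v₀.adicCompletion K))).toAffine.Nonsingular
          (a₀ : v₀.adicCompletion K) (b₀ : v₀.adicCompletion K)),
        Affine.Point.congrEquiv hC' (VariableChange.pointEquiv (W'.baseChange (v₀.adicCompletion K)) C' T) =
          .some _ _ h ∧
        (M'.map (IsLocalRing.residue (v₀.adicCompletionIntegers K))).toAffine.Nonsingular
          (IsLocalRing.residue (v₀.adicCompletionIntegers K) a₀)
          (IsLocalRing.residue (v₀.adicCompletionIntegers K) b₀)) :
    ∃ c : W.sha, c ≠ 0 ∧ 3 • c = 0 := by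
  obtain ⟨a₀, b₀, hns₀, hm, h3⟩ := exists_identityComponent_torsion_of_card W M C hC hcard hE0
  obtain ⟨a₀', b₀', hns₀', hm', h3'⟩ := exists_identityComponent_torsion_of_card W' M' C' hC' hcard' hE0'
  exact exists_sha_ne_zero_of_congr_of_identityComponent W W' θ hθ S hS hfin hcop P₁ P₂ hind v₀ h3v hO3 hδ
    hnoroot hn3 hoff hcard hcard' M C hC x₀ y₀ a hcusp hns₀ hm h3 M' C' hC' x₀' y₀' a' hcusp' hns₀' hm' h3'

end Summit.BirchSwinnertonDyer.Rank1Residual.GaloisImage.TwistedWitness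

end
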